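import Mathlib
import Summits.ResolutionOfSingularities.ResolutionOfSingularities.Theorems.WeightedInvariantLocalWeightedDropPolyDescentCompare
import Summits.ResolutionOfSingularities.ResolutionOfSingularities.Theorems.WeightedInvariantLocalWeightedDropMonicDescentChartSubst
import Summits.ResolutionOfSingularities.ResolutionOfSingularities.Theorems.WeightedInvariantLocalWeightedDropMonicDescentTailPointStep
import Summits.ResolutionOfSingularities.ResolutionOfSingularities.Theorems.WeightedInvariantLocalWeightedDropMonicDescentShearRecentre
import Summits.ResolutionOfSingularities.ResolutionOfSingularities.Theorems.WeightedInvariantLocalWeightedDropWildMonicShiftOrder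

/-!
# `WeightedInvariant.LocalWeightedDrop`, stub S3ρ: the monic polyhedron descent — TAIL TOOLS: shears vs the moves, permissibility as divisibility,
# positions vs re-centrings, and the POSITIONS OF THE CHARTS OF A WELL-PREPARED LABEL BY MINIMALITY (piece ρ-T, part 3b)

Crux item stmt-ResolutionOfSingularities-8899 `LocalWeightedDrop` (route `ResolutionOfSingularities/WeightedInvariant`), registered skeleton v30
(09f812eb3be8b7d8), stub S3ρ `stub_wildMonicSurfaceReductionWon`.  [OURS · L1 W4.3, chain w43, lead prover (gen 3); a LINE UNDER THE STUB: the
monic polyhedron descent (memo `L/res-L1-w43-lead-1/g3/S3RHO-CJS-MEMO.md`, line file `poly_descent_line_v1.lean` evidence on stmt-8899), MODEL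
Cossart–Jannsen–Saito LNM 2270 Ch. 8/11–13 for `J = (y^d + Σ_{j<d} A_j y^j)`, `e = 2`, `k` a field; nothing here is a statement of any manuscript.]

* `shearT_zero`, `shearT_X_mul_shearT_C`, `blowOneT_shearT_X_mul`, `divOneT_shearT` — the slotwise `u₂`-shear against the `u₁`-chart and the `V(y,u₁)`-blow-up
  (slot by slot `MonicDescent.blowOne_shear` / `divOne_shear`);
* `isPermissibleOneT_iff_X_pow_dvd`, `isPermissibleOneT_shift_X_mul` — `V(y,u₁)`-permissibility is divisibility by `u₁^{d−j}`, kept by re-centring by a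
  multiple of `u₁`;
* `shift_apply_zero`, `constantCoeff_eq_zero_of_isPosT_shift` — if `S` and `shift S χ` are positions then `χ(0) = 0` (slot `0`);
* `isPosT_of_forall_factorial_lt`, `isPermissibleOneT_of_factorial_le_alphaL`, `isPermissibleTwoT_of_factorial_le_epsL`, `factorial_le_fst_of_isPermissibleOneT`
  — positions / permissibility read off the `d!`-scaled Newton set;
* `isPosT_blowOneT_of_shift`, `isPosT_divOneT_of_shift` — given Hironaka's minimality (ρ-M) as the hypothesis `hmin`: if a chart of some re-centred
  competitor of a well-prepared position `B` is a position, so is the same chart of `B` (weights `(1,2)` resp. `(1,1)`).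
-/

set_option linter.dupNamespace false -- mandated namespace of this single-conjunct summit

noncomputable section

namespace Summit.ResolutionOfSingularities.ResolutionOfSingularities.Theorems

namespace PolyDescent

open MvPowerSeries MonicDescent WildMonic Literature.RingTheory.TwoVariableSeries Literature.AlgebraicGeometry.Resolution

variable {k : Type} [Field k]

/-! ## Slotwise shear bookkeeping -/

/-- The trivial shear. -/
theorem shearT_zero {d : ℕ} (A : Fin d → MvPowerSeries (Fin 2) k) : shearT 0 A = A :=
  funext fun j => shear_zero_eq (A j)

/-- The tail relation slot by slot: `shearT (u₁h′) (shearT (C c) A) = shearT (C c + u₁h′) A`. -/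
theorem shearT_X_mul_shearT_C {d : ℕ} (h' : MvPowerSeries (Fin 2) k) (A : Fin d → MvPowerSeries (Fin 2) k) (c : k) :
    shearT (X 0 * h') (shearT (C c) A) = shearT (C c + X 0 * h') A :=
  funext fun j => shear_X_mul_shear_C h' (A j) c

/-- The `u₁`-chart of a tuple sheared by `u₁g`, `g = g(u₁)`, is the `u₁`-chart sheared by `g` (slotwise `MonicDescent.blowOne_shear`, CJS `v⁽¹⁾ = v/u₁`). -/
theorem blowOneT_shearT_X_mul {d : ℕ} (g : MvPowerSeries (Fin 2) k) (Q : Fin d → MvPowerSeries (Fin 2) k)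
    (hg : ∀ e : Fin 2 →₀ ℕ, e 1 ≠ 0 → coeff e g = 0) (hQ : ∀ (j : Fin d) (e : Fin 2 →₀ ℕ), coeff e (Q j) ≠ 0 → d - (j : ℕ) ≤ e 0 + e 1) :
    blowOneT d (shearT (X 0 * g) Q) = shearT g (blowOneT d Q) :=
  funext fun j => blowOne_shear (d - (j : ℕ)) g (Q j) hg (hQ j)

/-- The `V(y,u₁)`-blow-up commutes with every shear on permissible tuples (slotwise `MonicDescent.divOne_shear`). -/
theorem divOneT_shearT {d : ℕ} (h : MvPowerSeries (Fin 2) k) {A : Fin d → MvPowerSeries (Fin 2) k} (hA : IsPermissibleOneT d A) :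
    divOneT d (shearT h A) = shearT h (divOneT d A) :=
  funext fun j => divOne_shear (d - (j : ℕ)) h (A j) (hA j)

/-! ## Permissibility as divisibility; re-centring by a multiple of `u₁` keeps `V(y,u₁)` permissible -/

/-- `V(y,u₁)`-permissibility slot by slot as divisibility by `u₁^{d−j}`. -/
theorem isPermissibleOneT_iff_X_pow_dvd {d : ℕ} (A : Fin d → MvPowerSeries (Fin 2) k) :
    IsPermissibleOneT d A ↔ ∀ j : Fin d, X 0 ^ (d - (j : ℕ)) ∣ A j := by
  unfold IsPermissibleOneT
  refine forall_congr' fun j => ?_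
  rw [X_pow_dvd_iff]
  constructor
  · intro h m hm
    by_contra hne
    exact absurd (h m hne) (not_le.mpr hm)
  · intro h e he
    by_contra hlt
    exact he (h e (not_le.mp hlt))

/-- Re-centring by a multiple of `u₁` keeps `V(y,u₁)` permissible (every term of `WildMonic.shift_eq` is divisible by `u₁^{d−i}`). -/
theorem isPermissibleOneT_shift_X_mul {d : ℕ} {S : Fin d → MvPowerSeries (Fin 2) k} (hS : IsPermissibleOneT d S)
    (g : MvPowerSeries (Fin 2) k) : IsPermissibleOneT d (shift d S (X 0 * g)) := by
  rw [isPermissibleOneT_iff_X_pow_dvd] at hS ⊢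
  intro i
  rw [shift_eq]
  refine dvd_add ?_ (Finset.dvd_sum fun j _ => ?_)
  · exact Dvd.dvd.mul_left (by rw [mul_pow]; exact Dvd.dvd.mul_right (dvd_refl _) _) _
  · by_cases hji : (j : ℕ) < (i : ℕ)
    · rw [Nat.choose_eq_zero_of_lt hji, Nat.cast_zero, zero_mul, zero_mul]; exact dvd_zero _
    · push Not at hji
      have hsplit : d - (i : ℕ) = (d - (j : ℕ)) + ((j : ℕ) - (i : ℕ)) := by have := j.2; omega
      rw [hsplit, pow_add]
      exact mul_dvd_mul (Dvd.dvd.mul_left (hS j) _) (by rw [mul_pow]; exact Dvd.dvd.mul_right (dvd_refl _) _)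

/-! ## Positions and re-centrings -/

/-- Slot `0` of a re-centred tuple: `(shift S χ)_0 = χ^d + Σ_j S_j χ^j` (`0 < d`). -/
theorem shift_apply_zero {d : ℕ} (hd : 0 < d) (S : Fin d → MvPowerSeries (Fin 2) k) (χ : MvPowerSeries (Fin 2) k) :
    shift d S χ ⟨0, hd⟩ = χ ^ d + ∑ j : Fin d, S j * χ ^ (j : ℕ) := by
  rw [shift_eq]
  simp only [Nat.choose_zero_right, Nat.cast_one, one_mul, Nat.sub_zero]

/-- A series of positive order has no constant term. -/
theorem constantCoeff_eq_zero_of_lt_order {F : MvPowerSeries (Fin 2) k} {c : ℕ} (hF : (c : ℕ∞) < F.order) : constantCoeff F = 0 := by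
  have h0 : coeff (0 : Fin 2 →₀ ℕ) F = 0 := coeff_of_lt_order (lt_of_le_of_lt (by simp) hF)
  simpa using h0

/-- If `S` and its re-centring `shift S χ` are both positions (`0 < d`), then `χ(0) = 0` (slot `0` is `χ^d + Σ S_j χ^j`, and neither it nor the
`S_j` have a constant term). -/
theorem constantCoeff_eq_zero_of_isPosT_shift {d : ℕ} (hd : 0 < d) {S : Fin d → MvPowerSeries (Fin 2) k} {χ : MvPowerSeries (Fin 2) k}
    (hS : IsPosT d S) (hS' : IsPosT d (shift d S χ)) : constantCoeff χ = 0 := by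
  have h0 : constantCoeff (shift d S χ ⟨0, hd⟩) = 0 := constantCoeff_eq_zero_of_lt_order (hS' ⟨0, hd⟩)
  rw [shift_apply_zero hd, map_add, map_pow, map_sum] at h0
  have hsum : ∑ j : Fin d, constantCoeff (S j * χ ^ (j : ℕ)) = 0 :=
    Finset.sum_eq_zero fun j _ => by rw [map_mul, constantCoeff_eq_zero_of_lt_order (hS j), zero_mul]
  rw [hsum, add_zero] at h0
  exact pow_eq_zero_iff hd.ne' |>.mp h0

/-- A tuple whose scaled Newton set lies in `P₀ + P₁ > d!` is a position. -/
theorem isPosT_of_forall_factorial_lt {d : ℕ} {A : Fin d → MvPowerSeries (Fin 2) k}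
    (h : ∀ P ∈ newtonSet A, d.factorial < P 0 + P 1) : IsPosT d A := by
  intro j
  have hlt : (((d - (j : ℕ) : ℕ) : ℕ∞)) < ((d - (j : ℕ) + 1 : ℕ) : ℕ∞) := by exact_mod_cast Nat.lt_succ_self _
  refine lt_of_lt_of_le hlt (nat_le_order fun e he => ?_)
  by_contra hne
  have hP := h (slotWeight d j • e) ⟨j, e, hne, rfl⟩
  simp only [Finsupp.smul_apply, smul_eq_mul, ← mul_add] at hP
  rw [← slotWeight_mul_sub j] at hP
  have hlt' : d - (j : ℕ) < e 0 + e 1 := Nat.lt_of_mul_lt_mul_left hP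
  have hdeg : Finsupp.degree e = e 0 + e 1 := by rw [Finsupp.degree_eq_sum]; simp [Fin.sum_univ_two]
  rw [hdeg] at he
  omega

/-- `V(y,u₁)` is permissible as soon as `d! ≤ α` (the scaled Newton set lies in `P₀ ≥ d!`). -/
theorem isPermissibleOneT_of_factorial_le_alphaL {d : ℕ} {A : Fin d → MvPowerSeries (Fin 2) k}
    (h : d.factorial ≤ alphaL (newtonSet A)) : IsPermissibleOneT d A := by
  intro j e he
  have hP := le_trans h (alphaL_le (N := newtonSet A) ⟨j, e, he, rfl⟩)
  rw [Finsupp.smul_apply, smul_eq_mul, ← slotWeight_mul_sub j] at hP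
  exact Nat.le_of_mul_le_mul_left hP (slotWeight_pos j)

/-- `V(y,u₂)` is permissible as soon as `d! ≤ ε` (the scaled Newton set lies in `P₁ ≥ d!`). -/
theorem isPermissibleTwoT_of_factorial_le_epsL {d : ℕ} {A : Fin d → MvPowerSeries (Fin 2) k}
    (h : d.factorial ≤ epsL (newtonSet A)) : IsPermissibleTwoT d A := by
  intro j e he
  have hP := le_trans h (epsL_le (N := newtonSet A) ⟨j, e, he, rfl⟩)
  rw [Finsupp.smul_apply, smul_eq_mul, ← slotWeight_mul_sub j] at hP
  exact Nat.le_of_mul_le_mul_left hP (slotWeight_pos j)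

/-- At a `V(y,u₁)`-permissible tuple every scaled point has `P₀ ≥ d!`. -/
theorem factorial_le_fst_of_isPermissibleOneT {d : ℕ} {A : Fin d → MvPowerSeries (Fin 2) k} (hA : IsPermissibleOneT d A) :
    ∀ P ∈ newtonSet A, d.factorial ≤ P 0 := by
  rintro P ⟨j, e, he, rfl⟩
  rw [Finsupp.smul_apply, smul_eq_mul, ← slotWeight_mul_sub j]
  exact Nat.mul_le_mul_left _ (hA j e he)

/-! ## Positions of the charts of a well-prepared label, by minimality (Hironaka) against a re-centred competitor -/

section Minimality

variable {d : ℕ}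
  (hmin : ∀ (B : Fin d → MvPowerSeries (Fin 2) k) (ψ : MvPowerSeries (Fin 2) k), WellPrepared d B → IsPosT d B → constantCoeff ψ = 0 →
    ∀ w : Fin 2 → ℕ, (∀ i, 0 < w i) → ∀ P ∈ newtonSet B, ∃ Q ∈ newtonSet (shift d B ψ), Finsupp.weight w Q ≤ Finsupp.weight w P)
include hmin

/-- POINT STEP: if the `u₁`-chart of some re-centring `shift B ψ` (a position) of the well-prepared position `B` is a position, so is the `u₁`-chart of
`B` itself (minimality with the weight `(1,2)`: `blowOneT` is a position iff `P₀ + 2P₁ > 2·d!` on the scaled Newton set). -/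
theorem isPosT_blowOneT_of_shift {B : Fin d → MvPowerSeries (Fin 2) k} {ψ : MvPowerSeries (Fin 2) k} (hWP : WellPrepared d B) (hpos : IsPosT d B)
    (hψ : constantCoeff ψ = 0) (hpos' : IsPosT d (shift d B ψ)) (hpos'' : IsPosT d (blowOneT d (shift d B ψ))) : IsPosT d (blowOneT d B) := by
  apply isPosT_of_forall_factorial_lt
  rw [newtonSet_blowOneT B hpos]
  rintro _ ⟨P, hP, rfl⟩
  rw [psi_apply_zero, psi_apply_one]
  have hPs := factorial_le_sum_of_isPosT hpos P hP
  obtain ⟨Q, hQ, hQP⟩ := hmin B ψ hWP hpos hψ (fun i => if i = 0 then 1 else 2) (fun i => by split_ifs <;> decide) P hP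
  rw [weight_fin_two_eq, weight_fin_two_eq] at hQP
  have hQs := factorial_le_sum_of_isPosT hpos' Q hQ
  have hQ' := factorial_lt_sum_of_isPosT hpos'' (psi d.factorial Q) (by rw [newtonSet_blowOneT _ hpos']; exact ⟨Q, hQ, rfl⟩)
  rw [psi_apply_zero, psi_apply_one] at hQ'
  omega

/-- CURVE STEP: if the `V(y,u₁)`-blow-up of some `V(y,u₁)`-permissible re-centring `shift B ψ` of the well-prepared `V(y,u₁)`-permissible position `B`
is a position, so is the `V(y,u₁)`-blow-up of `B` (minimality with the weight `(1,1)`: `divOneT` is a position iff `P₀ + P₁ > 2·d!`). -/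
theorem isPosT_divOneT_of_shift {B : Fin d → MvPowerSeries (Fin 2) k} {ψ : MvPowerSeries (Fin 2) k} (hWP : WellPrepared d B) (hpos : IsPosT d B)
    (hP1 : IsPermissibleOneT d B) (hψ : constantCoeff ψ = 0) (hP1' : IsPermissibleOneT d (shift d B ψ))
    (hpos'' : IsPosT d (divOneT d (shift d B ψ))) : IsPosT d (divOneT d B) := by
  apply isPosT_of_forall_factorial_lt
  rw [newtonSet_divOneT B hP1]
  rintro _ ⟨P, hP, rfl⟩
  beta_reduce
  have hP0 := shiftOneF_fst hP1 P hP
  have hP1c := shiftOneF_snd d B P hP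
  obtain ⟨Q, hQ, hQP⟩ := hmin B ψ hWP hpos hψ (fun i => if i = 0 then 1 else 1) (fun i => by split_ifs <;> decide) P hP
  rw [weight_fin_two_eq, weight_fin_two_eq] at hQP
  have hQ0 := shiftOneF_fst hP1' Q hQ
  have hQ1 := shiftOneF_snd d (shift d B ψ) Q hQ
  have hQ' := factorial_lt_sum_of_isPosT hpos'' _ (by rw [newtonSet_divOneT _ hP1']; exact ⟨Q, hQ, rfl⟩)
  beta_reduce at hQ'
  omega

end Minimality

end PolyDescent

end Summit.ResolutionOfSingularities.ResolutionOfSingularities.Theorems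

end
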